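import Summits.Ventures.CertifiedManyBodySolver.Theorems.R2cStripCellConsumerDyadic
import Summits.Ventures.CertifiedManyBodySolver.Theorems.R2cGcTangentConsumer
import Literature.MathematicalPhysics.QuantumLattice.HubbardNNNHoppingEnergyDensityConvex
import HarnessLib

/-!
# Strip-cell uMPS certificates as thermodynamic-limit UPPER ROWS at any exact filling

HONEST FRAMING: first certified bounds; not a superconductivity verdict; every number certified or labelled float.
NO NUMBER IS CLAIMED HERE: the theorem is an implication from the data a strip-cell certificate asserts.

`Theorems/R2cStripCellConsumer.lean` pins the route's numbers (filling `7/8`, bar `−18/25`). This file is the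
ROW-MAKER: an `a = ∞` strip-cell certificate (METHOD-umps U1 on cells of `c` columns of the `W`-wide open strip,
`t′ = 0`, `U ≥ 0`) with EXACT cell charge `Q_c` yields the thermodynamic-limit upper bound
`energyDensityTT' t 0 U (Q_c/(c·W)) ≤ c_cert/(c·W)` at the cell's own density — the 2-D analogue of the chain rows
#408/#409 (`Certificates/HubbardChain_doped_fmps_upper_a1024_U8_rows408_409.lean`). The finite objects are the
number-INDEFINITE boundary-propagated mixtures of `Theorems/R2cStripCellConsumer.lean` (norm `1`, energy
`≤ (k−1)c_cert + 2|z| + K`, particle number `k·Q_c ± (qmax − qmin)`); the mean number pinned to `k·Q_c` up to a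
k-free defect is exactly what the grand-canonical all-`k` consumer `energyDensityTT'_le_of_gcFamily_right_anyBox`
(`Theorems/R2cGcTangentConsumer.lean`) digests, with the chemical potential taken to be a SUPPORTING SLOPE of the
convex function `x ↦ e(t, 0, U, x)` at `ρ = Q_c/(cW)` (`exists_supporting_line_energyDensityTT'`, Literature):

* `stripCell_family_fock` — the family read back on Fock space (Jordan–Wigner), with its three clauses;
* **`energyDensityTT'_le_of_stripCell_umps_dual`** — THE ROW-MAKER (exactly isometric tensor);
* **`energyDensityTT'_le_of_stripCell_umps_dual_dyadic`** — the same for a STORED nearly isometric tensor via Lemma P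
  (`polarTensor_dual_certificate`, `polarTensor_charges`).

Sources: Ruelle (1969) §3.4 (convexity / supporting lines of the energy density) [Ruelle1969]; VAR `METHOD-umps.md`
Thm U1 and §3; route pen's `WRITER-II-SPEC.md` ("off density 7/8: one side only").
-/

noncomputable section

open Matrix Finset
open scoped ComplexOrder BigOperators

namespace Summit.Ventures.CertifiedManyBodySolver.Theorems

open Literature.MathematicalPhysics.QuantumLattice
open Literature.MathematicalPhysics.QuantumLattice.JordanWigner
open Literature.MathematicalPhysics.QuantumLattice.ThermodynamicLimit
open Literature.LinearAlgebra.Matrix.PolarOrthonormalization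
open Summit.Ventures.CertifiedManyBodySolver.Upper

variable {W c Q D : ℕ}

/-- **The strip-cell family on Fock space.** For `k ≥ 1` cells, the Jordan–Wigner preimages
`ψ_a = toSpinVec⁻¹ ((mpsOpen k A e_a r) ∘ superCfg)` of the boundary-propagated mixture on the open `(k·c) × W` box
have total norm `1`, energy `≤ (k−1)·c_cert + 2|z| + K` and particle number within `k·Q_c ± (qmax − qmin)`. -/
theorem stripCell_family_fock (hc : 0 < c) (κ : TensorIndex (Fin c ×ₗ Fin W) 4 ≃ Fin Q)
    {A : MPSTensor Q D} (hA : ∑ S, (A S)ᴴ * A S = 1) {r : Fin D → ℂ} (hr : star r ⬝ᵥ r = 1)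
    (Z : Matrix (Fin D) (Fin D) ℂ) (t : ℝ) {U cc z K : ℝ}
    (hdual : (((cc : ℝ) : ℂ) • (1 : Matrix (Fin D) (Fin D) ℂ) -
      dualMatrix A (stripCellBondMatrix κ hc t U) Z).PosSemidef)
    (hZ₁ : (((z : ℝ) : ℂ) • (1 : Matrix (Fin D) (Fin D) ℂ) - Z).PosSemidef)
    (hZ₂ : (((z : ℝ) : ℂ) • (1 : Matrix (Fin D) (Fin D) ℂ) + Z).PosSemidef)
    (hK : (((K : ℝ) : ℂ) • (1 : Matrix (Fin Q) (Fin Q) ℂ) -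
      superSite κ (toSpin (hubbardOpenBoxTT' c W t 0 U))).PosSemidef)
    (lab : Fin D → ℤ) (Qc : ℤ)
    (hBC : ∀ (S : Fin Q) (α β : Fin D), A S α β ≠ 0 →
      lab β + Qc = lab α + ((∑ f, siteCharge (κ.symm S f) : ℕ) : ℤ))
    {qmin qmax : ℤ} (hlab : ∀ α, qmin ≤ lab α ∧ lab α ≤ qmax) (k : ℕ) (hk : 1 ≤ k) :
    let ψ : Fin D → Fock (Orb (Fin (k * c) ×ₗ Fin W)) := fun l =>
      toSpinVec.symm (fun σ => mpsOpen k A (Pi.single l 1) r (superCfg (stripCells k c W) κ σ))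
    (∑ l, (star (ψ l) ⬝ᵥ ψ l).re = 1) ∧
      (∑ l, (star (ψ l) ⬝ᵥ (hubbardOpenBoxTT' (k * c) W t 0 U *ᵥ ψ l)).re ≤ ((k : ℝ) - 1) * cc + 2 * |z| + K) ∧
      ((k : ℝ) * ((Qc : ℤ) : ℝ) - (((qmax : ℤ) : ℝ) - ((qmin : ℤ) : ℝ)) ≤
          ∑ l, (star (ψ l) ⬝ᵥ (totalNumber *ᵥ ψ l)).re) ∧
      (∑ l, (star (ψ l) ⬝ᵥ (totalNumber *ᵥ ψ l)).re ≤
          (k : ℝ) * ((Qc : ℤ) : ℝ) + (((qmax : ℤ) : ℝ) - ((qmin : ℤ) : ℝ))) := by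
  intro ψ
  -- Jordan–Wigner: the three quadratic forms read on the spin side
  have hn : ∀ l, star (ψ l) ⬝ᵥ ψ l =
      star (fun σ => mpsOpen k A (Pi.single l 1) r (superCfg (stripCells k c W) κ σ)) ⬝ᵥ
        (fun σ => mpsOpen k A (Pi.single l 1) r (superCfg (stripCells k c W) κ σ)) := fun l => by
    rw [← star_toSpinVec_dotProduct, LinearEquiv.apply_symm_apply]
  have hH : ∀ l, star (ψ l) ⬝ᵥ (hubbardOpenBoxTT' (k * c) W t 0 U *ᵥ ψ l) =
      star (fun σ => mpsOpen k A (Pi.single l 1) r (superCfg (stripCells k c W) κ σ)) ⬝ᵥ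
        (toSpin (hubbardOpenBoxTT' (k * c) W t 0 U) *ᵥ
          fun σ => mpsOpen k A (Pi.single l 1) r (superCfg (stripCells k c W) κ σ)) := fun l => by
    have h := expect_eq (hubbardOpenBoxTT' (k * c) W t 0 U) (ψ l)
    rwa [Literature.MathematicalPhysics.QuantumLattice.expect, LinearEquiv.apply_symm_apply] at h
  have hN : ∀ l, star (ψ l) ⬝ᵥ (totalNumber *ᵥ ψ l) =
      star (fun σ => mpsOpen k A (Pi.single l 1) r (superCfg (stripCells k c W) κ σ)) ⬝ᵥ
        ((∑ x : Fin (k * c) ×ₗ Fin W, onSite x siteTotalNumber) *ᵥ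
          fun σ => mpsOpen k A (Pi.single l 1) r (superCfg (stripCells k c W) κ σ)) := fun l => by
    have h := expect_eq (totalNumber (Λ := Fin (k * c) ×ₗ Fin W)) (ψ l)
    rwa [Literature.MathematicalPhysics.QuantumLattice.expect, LinearEquiv.apply_symm_apply,
      toSpin_totalNumber] at h
  simp only [hn, hH, hN]
  refine ⟨?_, stripCell_family_energy_le hc κ hA hr Z t hdual hZ₁ hZ₂ hK k hk,
    (stripCell_family_number_mem κ hA hr lab Qc hBC hlab k).1,
    (stripCell_family_number_mem κ hA hr lab Qc hBC hlab k).2⟩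
  rw [← Complex.re_sum, stripCell_family_norm κ hA r k, hr, Complex.one_re]

/-- **ROW-MAKER: a strip-cell uMPS certificate bounds the 2-D thermodynamic-limit energy density at its own filling.**
DATA (`t′ = 0`, `U ≥ 0`): cell `c × W` (`c, W ≥ 1`), enumeration `κ`, an EXACTLY left-isometric cell tensor `A`, unit
boundary vector `r`, dual `Z`, reals `c_cert, z` with `c_cert·1 − W(A; stripCellBondMatrix κ hc t U, Z) ⪰ 0`,
`z·1 ∓ Z ⪰ 0`; integer bond labels in `[qmin, qmax]` with the `U(1)` block rule and cell charge `0 < Q_c < 2cW`.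
THEN `e(t, 0, U, Q_c/(cW)) ≤ c_cert/(cW)`. Proof: the GC all-`k` consumer `energyDensityTT'_le_of_gcFamily_right_anyBox`
with `μ = s` a supporting slope of `e` at `ρ = Q_c/(cW)`, `E + Δ = c_cert − s·Q_c`, `M + Γ = Q_c`, fed with the
strip-cell family. [cite: Ruelle1969, §3.4] -/
theorem energyDensityTT'_le_of_stripCell_umps_dual (W c : ℕ) (hW : 1 ≤ W) (hc : 0 < c)
    (κ : TensorIndex (Fin c ×ₗ Fin W) 4 ≃ Fin Q) (A : MPSTensor Q D) (hA : ∑ S, (A S)ᴴ * A S = 1)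
    (r : Fin D → ℂ) (hr : star r ⬝ᵥ r = 1) (Z : Matrix (Fin D) (Fin D) ℂ) (t : ℝ) {U : ℝ} (hU : 0 ≤ U)
    {cc z : ℝ}
    (hdual : (((cc : ℝ) : ℂ) • (1 : Matrix (Fin D) (Fin D) ℂ) -
      dualMatrix A (stripCellBondMatrix κ hc t U) Z).PosSemidef)
    (hZ₁ : (((z : ℝ) : ℂ) • (1 : Matrix (Fin D) (Fin D) ℂ) - Z).PosSemidef)
    (hZ₂ : (((z : ℝ) : ℂ) • (1 : Matrix (Fin D) (Fin D) ℂ) + Z).PosSemidef)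
    (lab : Fin D → ℤ) (Qc qmin qmax : ℤ)
    (hBC : ∀ (S : Fin Q) (α β : Fin D), A S α β ≠ 0 →
      lab β + Qc = lab α + ((∑ f, siteCharge (κ.symm S f) : ℕ) : ℤ))
    (hlab : ∀ α, qmin ≤ lab α ∧ lab α ≤ qmax) (hQ0 : 0 < Qc) (hQ2 : Qc < 2 * ((c : ℤ) * (W : ℤ))) :
    energyDensityTT' t 0 U (((Qc : ℤ) : ℝ) / ((c : ℝ) * (W : ℝ))) ≤ cc / ((c : ℝ) * (W : ℝ)) := by
  have hcW : (0 : ℝ) < (c : ℝ) * (W : ℝ) := by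
    have : (0 : ℕ) < c * W := Nat.mul_pos hc hW
    exact_mod_cast this
  set ρ : ℝ := ((Qc : ℤ) : ℝ) / ((c : ℝ) * (W : ℝ)) with hρ
  have hρ0 : 0 < ρ := div_pos (by exact_mod_cast hQ0) hcW
  have hρ2 : ρ < 2 := by
    rw [hρ, div_lt_iff₀ hcW]
    have : ((Qc : ℤ) : ℝ) < 2 * ((c : ℝ) * (W : ℝ)) := by exact_mod_cast hQ2
    linarith
  have hρcW : ρ * ((c : ℝ) * (W : ℝ)) = ((Qc : ℤ) : ℝ) := div_mul_cancel₀ _ hcW.ne'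
  -- the last-cell constant
  obtain ⟨K, hK₀⟩ := exists_nat_smul_one_sub_posSemidef (hubbardOpenBoxTT' c W t 0 U)
    (hubbardOpenBoxTT'_isHermitian c W t 0 U)
  have hK : ((((K : ℕ) : ℝ) : ℂ) • (1 : Matrix (Fin Q) (Fin Q) ℂ) -
      superSite κ (toSpin (hubbardOpenBoxTT' c W t 0 U))).PosSemidef := by
    have h1 : superSite κ (toSpin ((((K : ℕ) : ℝ) : ℂ) •
        (1 : Matrix (Finset (Orb (Fin c ×ₗ Fin W))) (Finset (Orb (Fin c ×ₗ Fin W))) ℂ) - hubbardOpenBoxTT' c W t 0 U)) =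
        (((K : ℕ) : ℝ) : ℂ) • (1 : Matrix (Fin Q) (Fin Q) ℂ) - superSite κ (toSpin (hubbardOpenBoxTT' c W t 0 U)) := by
      rw [map_sub, map_smul, map_sub, map_smul, superSite_toSpin_one]
    rw [← h1, posSemidef_superSite_iff, posSemidef_toSpin_iff]
    exact hK₀
  -- a supporting slope of the convex energy density at `ρ`
  obtain ⟨s, hs⟩ := exists_supporting_line_energyDensityTT' t 0 hU hρ0 hρ2
  set qd : ℝ := ((qmax : ℤ) : ℝ) - ((qmin : ℤ) : ℝ) with hqd
  have hc1 : 1 ≤ c := hc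
  refine energyDensityTT'_le_of_gcFamily_right_anyBox t 0 hU s (cc / ((c : ℝ) * (W : ℝ))) le_rfl hs hc1 hW
    (E := 2 * |z| + K + |s| * qd - s * ((Qc : ℤ) : ℝ)) (Δ := cc - 2 * |z| - K - |s| * qd)
    (M := ((Qc : ℤ) : ℝ) - qd) (Γ := qd) ?_ ?_ ?_
  · -- `E + Δ = c_cert − s·Q_c = (c_cert/(cW) − s ρ)·(cW)`
    rw [sub_mul, div_mul_cancel₀ _ hcW.ne', mul_assoc, hρcW]
    linarith
  · rw [hρcW]
    linarith
  · intro k hk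
    obtain ⟨hS, hE, hNlo, hNhi⟩ := stripCell_family_fock hc κ hA hr Z t hdual hZ₁ hZ₂ hK lab Qc hBC hlab k hk
    refine ⟨k * c, W, Nat.mul_pos hk hc, hW, by ring, D, fun l =>
      toSpinVec.symm (fun σ => mpsOpen k A (Pi.single l 1) r (superCfg (stripCells k c W) κ σ)), ?_, ?_, ?_⟩
    · rw [hS]; exact one_pos
    · rw [hS, mul_one]
      set N := ∑ l, (star (toSpinVec.symm (fun σ => mpsOpen k A (Pi.single l 1) r
        (superCfg (stripCells k c W) κ σ))) ⬝ᵥ (totalNumber *ᵥ toSpinVec.symm (fun σ =>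
          mpsOpen k A (Pi.single l 1) r (superCfg (stripCells k c W) κ σ)))).re with hNdef
      have hdev : |N - (k : ℝ) * ((Qc : ℤ) : ℝ)| ≤ qd := abs_sub_le_iff.2 ⟨by linarith, by linarith⟩
      have hsN : -(s * N) ≤ -(s * ((k : ℝ) * ((Qc : ℤ) : ℝ))) + |s| * qd := by
        have h1 : -(s * (N - (k : ℝ) * ((Qc : ℤ) : ℝ))) ≤ |s| * qd :=
          (neg_le_abs _).trans (by rw [abs_mul]; exact mul_le_mul_of_nonneg_left hdev (abs_nonneg s))
        linarith
      nlinarith [hE, hsN]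
    · rw [hS, mul_one]
      linarith

/-- **ROW-MAKER for STORED (nearly isometric) tensors** (Lemma P): as `energyDensityTT'_le_of_stripCell_umps_dual`
with the stored tensor `A`, its Gram row-sum defect `ε < 1`, `γ·1 ∓ hh ⪰ 0`, the slack
`η ≥ (1 + 1/(1−ε))·(ε/(1−ε))·(1+ε)·(γ(1+(1+ε)) + z)` and the certified `(c_cert − η)·1 − W(A; hh, Z) ⪰ 0`.
[cite: Ruelle1969, §3.4] -/
theorem energyDensityTT'_le_of_stripCell_umps_dual_dyadic (W c : ℕ) (hW : 1 ≤ W) (hc : 0 < c)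
    (κ : TensorIndex (Fin c ×ₗ Fin W) 4 ≃ Fin Q) (A : MPSTensor Q D) (t : ℝ) {U : ℝ} (hU : 0 ≤ U)
    {ε γ η cc z : ℝ} (hε0 : 0 ≤ ε) (hε1 : ε < 1) (hγ : 0 ≤ γ) (hz : 0 ≤ z)
    (hG : ∀ i, ∑ j, ‖(Upper.gram A - 1) i j‖ ≤ ε)
    (hX₁ : ((γ : ℂ) • (1 : Matrix (Fin Q × Fin Q) (Fin Q × Fin Q) ℂ) - stripCellBondMatrix κ hc t U).PosSemidef)
    (hX₂ : ((γ : ℂ) • (1 : Matrix (Fin Q × Fin Q) (Fin Q × Fin Q) ℂ) + stripCellBondMatrix κ hc t U).PosSemidef)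
    (r : Fin D → ℂ) (hr : star r ⬝ᵥ r = 1) (Z : Matrix (Fin D) (Fin D) ℂ)
    (hZ₁ : (((z : ℝ) : ℂ) • (1 : Matrix (Fin D) (Fin D) ℂ) - Z).PosSemidef)
    (hZ₂ : (((z : ℝ) : ℂ) • (1 : Matrix (Fin D) (Fin D) ℂ) + Z).PosSemidef)
    (hη : (1 + 1 / (1 - ε)) * (ε / (1 - ε)) * (1 + ε) * (γ * (1 + (1 + ε)) + z) ≤ η)
    (hdual : (((cc - η : ℝ) : ℂ) • (1 : Matrix (Fin D) (Fin D) ℂ) -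
      dualMatrix A (stripCellBondMatrix κ hc t U) Z).PosSemidef)
    (lab : Fin D → ℤ) (Qc qmin qmax : ℤ)
    (hBC : ∀ (S : Fin Q) (α β : Fin D), A S α β ≠ 0 →
      lab β + Qc = lab α + ((∑ f, siteCharge (κ.symm S f) : ℕ) : ℤ))
    (hlab : ∀ α, qmin ≤ lab α ∧ lab α ≤ qmax) (hQ0 : 0 < Qc) (hQ2 : Qc < 2 * ((c : ℤ) * (W : ℤ))) :
    energyDensityTT' t 0 U (((Qc : ℤ) : ℝ) / ((c : ℝ) * (W : ℝ))) ≤ cc / ((c : ℝ) * (W : ℝ)) := by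
  obtain ⟨hiso, hdual'⟩ := polarTensor_dual_certificate hε0 hε1 hγ hz hG hX₁ hX₂ hZ₁ hZ₂ hη hdual
  exact energyDensityTT'_le_of_stripCell_umps_dual W c hW hc κ (polarTensor A) hiso r hr Z t hU hdual' hZ₁ hZ₂
    lab Qc qmin qmax (polarTensor_charges _ lab Qc hBC) hlab hQ0 hQ2

end Summit.Ventures.CertifiedManyBodySolver.Theorems

end
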